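import Summits.BirchSwinnertonDyer.Rank1Residual.Additive.CyclotomicThreeRankOneOneTwistDescentData
import Summits.BirchSwinnertonDyer.Rank1Residual.Additive.XGordRankZeroOneCyclotomicThreePrep
import Summits.BirchSwinnertonDyer.Rank1Residual.Additive.GordBranchPAdicGrossZagierOdd
import Summits.BirchSwinnertonDyer.Rank1Residual.Additive.CyclotomicZpExtensionQuadratic
import Summits.BirchSwinnertonDyer.Rank1Residual.Additive.RamifiedTwistMinimality
import Literature.NumberTheory.EllipticCurves.PAdicBSDInterpolationProofs
import HarnessLib

/-!
# Sub-target (S9): the `K`-side LOWER half at `p = 3` over `K = ℚ(ζ₃)` in ranks `(r_an V, r_an W) = (1,1)` —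
# `ord₃ #Ш_an(V) + ord₃ #Ш_an(W) ≤ ord₃ #Ш(V) + ord₃ #Ш(W)` for the ADDITIVE twist `W ≅ V^{(−3)}` of analytic
# rank ONE of a good ordinary `V = E♭` of analytic rank ONE (rank TWO over `K`) — NO anomalous proviso
# (cell `b2b-bsdres`, team n1011, seat p16; OWNERS row T-S9-K, PROPOSED under R3-25 (f))

HONEST FRAMING (cell `b2b-bsdres`, run/shared/lean/b2b/bsd-rank1-residual/, verbatim in every
file): the goal of the cell is to DELETE the COMBINATION-SHAPED residual classes of the
Birch–Swinnerton-Dyer formula for ALL analytic-rank `≤ 1` elliptic curves over `ℚ` — "full BSD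
formula for every rank `≤ 1` curve in class `C`" assembled STRICTLY from published theorems — so
that the rank-`≤ 1` remainder becomes exactly the CONSTRUCTION-SHAPED classes, which are TYPED
(missing-input `Prop`s), NOT attempted. This is not "finishing BSD". Team n1011 (N10 / N11 / O7),
seat p16: research route; labels and marks UNCHANGED; nothing booked; no Literature fact; no definition.

Theorems only. The `(1,1)` companion of `XGordRankOneZeroCyclotomicThreeLowerK` (`(0,1)`, p256600): the
100 ANOMALOUS rows (and 162 non-anomalous ones) of route planner 3's O7-ord ∩ (G-ord, `e = 2`)@3 cell with
`r_an(W) = r_an(E♭) = 1`, where no ℚ-side LOWER kernel is free of `hna`; over `K`, `V(K)` has rank `2` and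
Schneider's general-rank theorem for the GOOD ORDINARY `V_K` carries the exact factor `#Ṽ(𝔽₃)[3^∞]²`,
cancelled by `(1 − α⁻¹)²` of `[T¹]L₃(V,ω⁰,T)` (Perrin-Riou). INPUTS (explicit hypotheses; nothing asserted):
per row `C • V^{(−3)} = W`, `hord`, `hadd`, ranks, `(f, ϖ, ϖ')` for `V`, THE canonical `3`-adic datum `D₀` of
`V`, a datum `Dh` on `W(ℚ)` (intended: Delbourgo's `⟨,⟩_{3,ℚ} := ½⟨,⟩^{Sch}_{3,K}`), an algebra endomorphism
`σ` of `K` and a twisting transport `Φ : W(ℚ) →+ V(K)` doubling Néron–Tate heights and ANTI-invariant under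
`σ` (EXIST: `exists_conj_twistTransport`), the certificates `[T¹]L₃(V,ω⁰,T) ≠ 0`, `[T¹]L₃(V,ω¹,T) ≠ 0`;
published: **`hPR : perrinRiou_rankOne_leadingTerms_odd`** (Perrin-Riou 1987, odd `p` in print), `hTorK`
(Kato (A) over `K`), Milne 1972, GZK, modularity; THREE TYPED INPUTS — **`hLowK`** ((⊇/K), as in (S8): PLAN
§1.2 II.3's wall), **`hS2K`** (Schneider 1985 Thm. 2′ — general rank, `p` odd IN PRINT — for `V_K` in rank
TWO, the `K`-height `DK` restricting to `2·D₀` on `V(ℚ)` (`RestrictsTo`; Mazur–Stein–Tate 2006 §2.8: the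
`K`-height is the `ρ^ℚ_cyc ∘ N_{K/ℚ}`-height), along `Φ` to `2·Dh` (Delbourgo 2002 p. 39), and
Gal(K/ℚ)-INVARIANT (same norm formula); NOT discharged here), and **`hGZ : BranchPAdicGrossZagierOddAt W 3 Dh`**
(seat p01). Chain: (⊇/K) `ι(f_E) = ι(h)·ϖϖ'·L₃(V,ω⁰,T)·L₃(V,ω¹,T)`, both factors in `T·ℚ₃⟦T⟧` (`L(V,1) = 0`;
`constantCoeff_minusBranch_eq_zero_of_analyticRank_eq_one`) ⟹ `[T²]f_E = h(0)ϖϖ'[T¹]L⁺[T¹]B⁻`; Schneider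
(hS2K) × `M²` with `M²·Reg₃(V_K;B) = 4·Reg₃(V,D₀)·Reg₃(W,Dh)` (`sq_mul_padicGram_baseChange_eq_rankOneOne`:
Galois ORTHOGONALITY, `M = ad − bc` never bounded); Perrin-Riou (`rankOne_shaAn_data`) and p01's GZ;
cancelling `Reg₃Reg₃·#Ṽ[3^∞]²`: `ord₃(qϖ) + ord₃ q_W + 2ord₃ #V(K)_tors + ord₃ M² ≤ v(Tam V_K) + ord₃ #Ш(V_K)`;
Milne in rank `(1,1)` (`padicVal_card_identity_rankOneOne`, the same `ord₃ M²`) finishes. References: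
[Schneider1985] Thm. 2′; [GreenbergLNM1716] §4 p. 110–111; [PerrinRiou1987] §1.4 Cor. 1.8; [Delbourgo2002]
p. 39, Thm. (B); [Kato2004Asterisque] Thm. 17.4; [MazurTateTeitelbaum1986Invent] §I.14, §II.4–5;
[Milne1972ArithmeticAV] §1 Thm. 1; [MazurSteinTate2006] §2.8.
-/

noncomputable section

open scoped Classical MatrixGroups ModularForm

open CongruenceSubgroup WeierstrassCurve WeierstrassCurve.Affine.Point NumberField IsDedekindDomain
  Literature.NumberTheory.EllipticCurves Literature.NumberTheory.EllipticCurves.ModularForms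
  Literature.NumberTheory.EllipticCurves.Rank1Residual
  Literature.NumberTheory.EllipticCurves.Rank1Residual.Typed
  Literature.NumberTheory.GaloisRepresentations

namespace Summit.BirchSwinnertonDyer.Rank1Residual.Additive

section Core

variable (K : Type) [Field K] [NumberField K] [IsCyclotomicExtension {3} ℚ K]
  (V : WeierstrassCurve ℚ) [V.IsElliptic] [V.IsGloballyMinimal]
  (W : WeierstrassCurve ℚ) [W.IsElliptic] [W.IsGloballyMinimal]

/-- **Core theorem ((S9): the `K`-side LOWER half at `p = 3`, ranks `(r_an V, r_an W) = (1,1)`).** `V/ℚ`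
globally minimal, good ORDINARY at `3`, `r_an(V) = 1`; `W = C • V^{(−3)}` globally minimal, ADDITIVE at `3`,
`r_an(W) = 1`; `(f, ϖ, ϖ')` the newform and period ratios of `V`; `D₀` THE canonical `3`-adic datum of `V`,
`Dh` a datum on `W(ℚ)`; `σ`, `Φ` (height-doubling, `σ_*(ΦP) = −ΦP`); the two certificates. ASSUME the
PUBLISHED `hPR` (Perrin-Riou 1987, odd `p`), `hTorK`, Milne 1972, GZK, modularity, and the typed **`hLowK`**
((⊇/K)), **`hS2K`** (Schneider/K rank two + height clauses), **`hGZ`** (seat p01). THEN `#Ш_an(V) = q_V`,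
`#Ш_an(W) = q_W` with **`ord₃ q_V + ord₃ q_W ≤ ord₃ #Ш(V) + ord₃ #Ш(W)`**, anomalous rows included.
[cite: GreenbergLNM1716, §4 p. 110] [cite: PerrinRiou1987, §1.4 Cor. 1.8]
[cite: Delbourgo2002, p. 39 and Theorem (B) (p. 40) (shape of the height)]
[cite: Kato2004Asterisque, Thm. 17.4 (p. 273) (torsion clause)] [cite: Milne1972ArithmeticAV, §1 Thm. 1]
[cite: MazurTateTeitelbaum1986Invent, §I.14 and §II.4–5] -/
theorem XGordRankOneOneCyclotomicThreeLowerK.exists_padicVal_shaAn_add_le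
    (hPR : perrinRiou_rankOne_leadingTerms_odd)
    (hGZK : rank_eq_analyticRank_of_analyticRank_le_one) (hmod : hasEntireLFunction_rat)
    (hMilne : Milne1972.bsdQuotient_baseChange_quadratic_anyModel)
    (C : VariableChange ℚ) (hC : C • V.quadraticTwist (-(3 : ℚ)) = W)
    (σ : K →ₐ[ℚ] K) (Φ : W.toAffine.Point →+ (V.baseChange K).toAffine.Point)
    (hΦ : ∀ P : W.toAffine.Point, heightPairing (Φ P) (Φ P) = 2 * heightPairing P P)
    (hΦσ : ∀ P : W.toAffine.Point, QuadraticDescent.conjMap V σ (Φ P) = -Φ P)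
    (hord : IsOrdinaryAt V 3) (hadd : Addv W 3)
    (hrV : V.analyticRank = 1) (hrW : W.analyticRank = 1)
    {N : ℕ} [NeZero N] {f : CuspForm (Gamma0 N) 2} (hf : IsNewformOf V f)
    (ϖ ϖ' : ℚ) (hϖ : (ϖ : ℝ) * V.realPeriodRat = plusPeriod f)
    (hϖ' : (ϖ' : ℝ) * V.imaginaryPeriodRat = minusPeriod f)
    (D₀ : PAdicHeightData V 3) (hD₀ : D₀.IsCanonical) (Dh : PAdicHeightData W 3)
    (hcertV : PowerSeries.coeff 1 (padicLFunction f ((unitRoot V 3 : ℤ_[3]) : ℚ_[3])) ≠ 0)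
    (hcertW : PowerSeries.coeff 1
      (padicLFunctionMinusBranch f ((unitRoot V 3 : ℤ_[3]) : ℚ_[3]) 1) ≠ 0)
    (hGZ : BranchPAdicGrossZagierOddAt W 3 Dh)
    (hTorK : ∀ (κ : ZpExtension K 3) (γ : Field.absoluteGaloisGroup K),
      κ.IsCyclotomic → κ.IsTopGenerator γ →
      (∃ ζ : ℤ_[3]ˣ, IsOfFinOrder ζ ∧
        ((GaloisRep.cyclotomicCharacter K 3 γ * ζ : ℤ_[3]ˣ) : ℤ_[3]) = (cyclotomicGenerator 3 : ℤ_[3])) →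
      ∀ D : (V.baseChange K).SelmerDualData κ γ, D.IsTorsion)
    (hLowK : ∀ (κ : ZpExtension K 3) (γ : Field.absoluteGaloisGroup K),
      κ.IsCyclotomic → κ.IsTopGenerator γ →
      (∃ ζ : ℤ_[3]ˣ, IsOfFinOrder ζ ∧
        ((GaloisRep.cyclotomicCharacter K 3 γ * ζ : ℤ_[3]ˣ) : ℤ_[3]) = (cyclotomicGenerator 3 : ℤ_[3])) →
      ∀ D : (V.baseChange K).SelmerDualData κ γ, ∀ g ∈ D.charIdeal, ∃ h : IwasawaAlgebra 3,
        iwasawaToPowerSeries 3 g =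
          iwasawaToPowerSeries 3 h *
            (PowerSeries.C ((ϖ : ℚ_[3]) * (ϖ' : ℚ_[3])) *
              (padicLFunction f ((unitRoot V 3 : ℤ_[3]) : ℚ_[3]) *
                padicLFunctionMinusBranch f ((unitRoot V 3 : ℤ_[3]) : ℚ_[3]) 1)))
    (hS2K : ∀ (κ : ZpExtension K 3) (γ : Field.absoluteGaloisGroup K),
      κ.IsCyclotomic → κ.IsTopGenerator γ →
      (∃ ζ : ℤ_[3]ˣ, IsOfFinOrder ζ ∧
        ((GaloisRep.cyclotomicCharacter K 3 γ * ζ : ℤ_[3]ˣ) : ℤ_[3]) = (cyclotomicGenerator 3 : ℤ_[3])) →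
      ∀ (D : (V.baseChange K).SelmerDualData κ γ) [Module.Finite (IwasawaAlgebra 3) D.X], D.IsTorsion →
      ∀ (fE : IwasawaAlgebra 3), D.charIdeal = Ideal.span {fE} →
        (V.baseChange K).mordellWeilRank = 2 →
        Finite (AddCommGroup.primaryComponent (V.baseChange K).sha 3) →
      ∀ (B : Fin 2 → (V.baseChange K).toAffine.Point), IsMordellWeilBasis B →
        PowerSeries.X ^ 2 ∣ fE ∧
        ∃ DK : PAdicHeightDataK V 3 K,
          DK.RestrictsTo D₀ ∧
          (∀ P P' : W.toAffine.Point, DK.pairing (Φ P) (Φ P') = 2 * Dh.pairing P P') ∧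
          (∀ x y, DK.pairing (QuadraticDescent.conjMap V σ x) (QuadraticDescent.conjMap V σ y) =
            DK.pairing x y) ∧
          ∃ u : ℤ_[3]ˣ,
            ((PowerSeries.coeff 2 fE : ℤ_[3]) : ℚ_[3]) * padicLog 3 (cyclotomicGenerator 3) ^ 2 *
                (Nat.card (AddCommGroup.primaryComponent (V.baseChange K).toAffine.Point 3) : ℚ_[3]) ^ 2 =
              ((u : ℤ_[3]) : ℚ_[3]) *
                (DK.pairing (B 0) (B 0) * DK.pairing (B 1) (B 1) - DK.pairing (B 0) (B 1) ^ 2) *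
                (3 : ℚ_[3]) ^ (padicValNat 3 (V.baseChange K).tamagawaProduct) *
                (Nat.card (AddCommGroup.primaryComponent
                  ((integralModelInt V).map (Int.castRingHom (ZMod 3))).toAffine.Point 3) : ℚ_[3]) ^ 2 *
                (Nat.card (AddCommGroup.primaryComponent (V.baseChange K).sha 3) : ℚ_[3])) :
    ∃ qV qW : ℚ, shaAn V = (qV : ℂ) ∧ shaAn W = (qW : ℂ) ∧
      padicValRat 3 qV + padicValRat 3 qW ≤ (padicValNat 3 V.shaOrder : ℤ) + padicValNat 3 W.shaOrder := by
  classical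
  have h2 : Module.finrank ℚ K = 2 := finrank_eq_two_of_isCyclotomicExtension_three (K := K)
  have hdK : (NumberField.discr K : ℚ) = -(3 : ℚ) := by rw [discr_cyclotomicThree K]; norm_num
  haveI : IsTotallyComplex K := isTotallyComplex_cyclotomicThree K
  have hC' : C • V.quadraticTwist (NumberField.discr K : ℚ) = W := by rw [hdK]; exact hC
  obtain ⟨hmwV, hfinV⟩ := hGZK V (by rw [hrV])
  obtain ⟨hmwW, hfinW⟩ := hGZK W (by rw [hrW])
  haveI : Finite V.sha := hfinV
  haveI : Finite W.sha := hfinW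
  have hr1V : V.mordellWeilRank = 1 := by rw [hmwV, hrV]
  have hr1W : W.mordellWeilRank = 1 := by rw [hmwW, hrW]
  haveI : (V.baseChange K).IsElliptic := by rw [WeierstrassCurve.baseChange]; infer_instance
  haveI : Module.Finite ℤ (V.baseChange K).toAffine.Point := (V.baseChange K).module_finite_point_holds
  have hd0 : (NumberField.discr K : ℚ) ≠ 0 := by rw [hdK]; norm_num
  haveI := V.isElliptic_quadraticTwist hd0
  have htw1 : (V.quadraticTwist (NumberField.discr K : ℚ)).mordellWeilRank = 1 := by
    rw [← mordellWeilRank_variableChange_holds (V.quadraticTwist (NumberField.discr K : ℚ)) C, hC', hr1W]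
  have hrK : (V.baseChange K).mordellWeilRank = 2 := by
    rw [V.mordellWeilRank_baseChange_of_finrank_eq_two_of_finite K h2, hr1V, htw1]
  obtain ⟨hshaK, hWR⟩ := hMilne V K h2 W ⟨C, hC'⟩ (V.baseChange K) ⟨1, one_smul _ _⟩ hfinV hfinW
  haveI : Finite (V.baseChange K).sha := hshaK
  have hfinShaKp : Finite (AddCommGroup.primaryComponent (V.baseChange K).sha 3) := .of_injective _ Subtype.val_injective
  -- Mordell–Weil bases: `{P₀}` of `V(ℚ)`, `{P₁}` of `W(ℚ)`, `B = (B₀, B₁)` of `V(K)`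
  obtain ⟨BV, hBV⟩ := V.exists_isMordellWeilBasis_holds
  obtain ⟨BW, hBW⟩ := W.exists_isMordellWeilBasis_holds
  obtain ⟨BK, hBK⟩ := (V.baseChange K).exists_isMordellWeilBasis_holds
  have hcardV : Fintype.card (Fin V.mordellWeilRank) = 1 := by rw [Fintype.card_fin, hr1V]
  have hcardW : Fintype.card (Fin W.mordellWeilRank) = 1 := by rw [Fintype.card_fin, hr1W]
  let kV : Fin V.mordellWeilRank := ⟨0, by omega⟩
  let kW : Fin W.mordellWeilRank := ⟨0, by omega⟩
  have hP₀ : IsMordellWeilBasis (fun _ : Fin 1 => BV kV) := isMordellWeilBasis_const_of_card_eq_one hBV hcardV kV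
  have hP₁ : IsMordellWeilBasis (fun _ : Fin 1 => BW kW) := isMordellWeilBasis_const_of_card_eq_one hBW hcardW kW
  set B : Fin 2 → (V.baseChange K).toAffine.Point := BK ∘ finCongr hrK.symm with hBdef
  have hB : IsMordellWeilBasis B := isMordellWeilBasis_finCongr hrK hBK
  obtain ⟨a, b, t, ht, hx⟩ := exists_eq_comb_add_torsion_of_isMordellWeilBasis_two hB (V.pointToBaseChange K (BV kV))
  obtain ⟨c, d, t', ht', hy⟩ := exists_eq_comb_add_torsion_of_isMordellWeilBasis_two hB (Φ (BW kW))
  -- Milne's identity in rank `(1,1)` (regulators eliminated; the term `ord₃ M²` kept)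
  obtain ⟨hM0, hm0, hvcard⟩ := padicVal_card_identity_rankOneOne K V W h2 3 (by norm_num) hC' hfinV hfinW
    hshaK hP₀ hP₁ hB σ Φ hΦ hΦσ ht ht' hx hy hWR
  have hvM : padicValRat 3 (V.baseChange K).modifiedTamagawaProduct = padicValNat 3 (V.baseChange K).tamagawaProduct :=
    padicValRat_modifiedTamagawaProduct_baseChange V 3
      (fun hdvd ↦ V.not_hasGoodReductionAtPrime_of_dvd_minimalDiscriminantInt 3 hdvd hord.1)
  rw [hvM] at hvcard
  have hvu : padicValRat 3 |(C.u : ℚ)| = 0 := by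
    have hu : padicValRat 3 (C.u : ℚ) = 0 :=
      padicValRat_u_eq_zero_of_twist_pm_p 3 (by norm_num) V W (Or.inl hord.1) (d := -(3 : ℤ)) (Or.inr rfl) C
        (by push_cast; exact hC)
    rcases abs_choice (C.u : ℚ) with h | h
    · rw [h, hu]
    · rw [h, padicValRat.neg, hu]
  -- the Iwasawa-theoretic inputs over `K`
  obtain ⟨κ, hκ, γ, hγ, hγ'⟩ := exists_isCyclotomic_isTopGenerator_cyclotomicThree K
  obtain ⟨D⟩ := (V.baseChange K).nonempty_selmerDualData_holds κ γ hγ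
  haveI : Module.Finite (IwasawaAlgebra 3) D.X :=
    (SelmerDualData.module_finite_of_isCyclotomic (W := V.baseChange K) (κ := κ) hκ D) hγ
  have hX : D.IsTorsion := hTorK κ γ hκ hγ hγ' D
  haveI : (Module.charIdeal (IwasawaAlgebra 3) D.X).IsPrincipal := charIdeal_isPrincipal_holds 3 D.X
  obtain ⟨fE, hchar⟩ := Submodule.IsPrincipal.principal (Module.charIdeal (IwasawaAlgebra 3) D.X)
  have hchar' : D.charIdeal = Ideal.span {fE} := hchar
  have hfEmem : fE ∈ D.charIdeal := by rw [hchar']; exact Ideal.mem_span_singleton_self fE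
  obtain ⟨h, hιfE⟩ := hLowK κ γ hκ hγ hγ' D fE hfEmem
  obtain ⟨-, DK, hres₀, hres₁, hinv, u₁, hu₁⟩ := hS2K κ γ hκ hγ hγ' D hX fE hchar' hrK hfinShaKp B hB
  -- the `3`-adic regulator factorisation `M²·Reg₃(V_K;B) = 4·Reg₃(V,D₀)·Reg₃(W,Dh)`
  have hfac := sq_mul_padicGram_baseChange_eq_rankOneOne K V W h2 hP₀ hP₁ B σ Φ hΦσ DK D₀ Dh hres₀ hres₁
    hinv ht ht' hx hy
  -- analytic side of `V` (Perrin-Riou) and of `W` (p01's typed GZ on the odd branch)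
  obtain ⟨q, hq0, hϖ0, hshaV, hpr⟩ := rankOne_shaAn_data V hPR hGZK 3 (by norm_num) hord hrV hf ϖ hϖ D₀ hD₀
  have hordG : GoodOrd V 3 := ⟨hord.1, hord.2⟩
  have hVW : ∃ C : VariableChange ℚ, C • V.quadraticTwist (-((3 : ℕ) : ℚ)) = W := ⟨C, by norm_num; exact hC⟩
  obtain ⟨u, qW, hlead, hpgz⟩ := hGZ V (by norm_num) hVW hordG hf ϖ' hϖ'
  have h32 : (3 / 2 : ℕ) = 1 := by norm_num
  rw [hr1W, pow_one, h32] at hpgz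
  have hB0 : PowerSeries.constantCoeff
      (padicLFunctionMinusBranch f ((unitRoot V 3 : ℤ_[3]) : ℚ_[3]) 1) = 0 := by
    simpa only [h32] using
      constantCoeff_minusBranch_eq_zero_of_analyticRank_eq_one W 3 hmod hadd hrW (by norm_num) V hVW hordG hf ϖ' hϖ'
  have hϖ'0 : ϖ' ≠ 0 := by
    rintro rfl
    have hper : 0 < minusPeriod f := IsNewform0.minusPeriod_pos_holds hf.1 hf.coeffField_eq_bot
    rw [← hϖ', Rat.cast_zero, zero_mul] at hper
    exact lt_irrefl _ hper
  have hΩW : (W.realPeriodRat : ℂ) ≠ 0 := by exact_mod_cast W.realPeriodRat_pos_holds.ne'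
  have hRegW : (W.regulator : ℂ) ≠ 0 := by exact_mod_cast (regulator_pos_holds W).ne'
  have htamW : (W.tamagawaProduct : ℂ) ≠ 0 := by exact_mod_cast W.tamagawaProduct_pos_holds.ne'
  have hshaW : shaAn W = ((qW * (W.torsionOrder : ℚ) ^ 2 / (W.tamagawaProduct : ℚ) : ℚ) : ℂ) := by
    rw [shaAn_def, hlead]; push_cast; field_simp
  -- `L₃(V,ω⁰,T)` has no constant term: `L(V,1) = 0`
  set a₀ : ℚ_[3] := ((unitRoot V 3 : ℤ_[3]) : ℚ_[3]) with ha₀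
  set Lp := padicLFunction f a₀ with hLpdef
  set Bm := padicLFunctionMinusBranch f a₀ 1 with hBmdef
  set sV : ℚ := ratPlusSymbol f 0 with hsV
  have hLV0 : V.entireLFunction 1 = 0 := by
    by_contra hne
    exact one_ne_zero (hrV ▸ (V.analyticRank_eq_zero_iff_holds (hmod V)).mpr hne)
  have hsV0 : sV = 0 := by
    have hLvalV : V.entireLFunction 1 = (((sV : ℝ) * plusPeriod f : ℝ) : ℂ) := hf.entireLFunction_one_eq
    have hper : 0 < plusPeriod f := IsNewform0.plusPeriod_pos_holds hf.1 hf.coeffField_eq_bot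
    have h' : (sV : ℝ) * plusPeriod f = 0 := by rw [hLV0] at hLvalV; exact_mod_cast hLvalV.symm
    exact_mod_cast (mul_eq_zero.mp h').resolve_right hper.ne'
  have hL0 : PowerSeries.constantCoeff Lp = 0 := by
    rw [hLpdef, ha₀, constantCoeff_padicLFunction_unitRoot hord hf, ← hsV, hsV0]; simp
  obtain ⟨L₁, hL₁⟩ := PowerSeries.X_dvd_iff.mpr hL0
  obtain ⟨B₁, hB₁⟩ := PowerSeries.X_dvd_iff.mpr hB0
  have hAV : PowerSeries.coeff 1 Lp = PowerSeries.constantCoeff L₁ := by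
    rw [hL₁, ← pow_one PowerSeries.X, PowerSeries.coeff_X_pow_mul', if_pos le_rfl, Nat.sub_self,
      PowerSeries.coeff_zero_eq_constantCoeff]
  have hAW : PowerSeries.coeff 1 Bm = PowerSeries.constantCoeff B₁ := by
    rw [hB₁, ← pow_one PowerSeries.X, PowerSeries.coeff_X_pow_mul', if_pos le_rfl, Nat.sub_self,
      PowerSeries.coeff_zero_eq_constantCoeff]
  -- `[T²]f_E = h(0)·ϖϖ'·[T¹]L⁺·[T¹]B⁻`
  have hcoeff_ιfE : ((PowerSeries.coeff 2 fE : ℤ_[3]) : ℚ_[3]) =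
      ((PowerSeries.constantCoeff h : ℤ_[3]) : ℚ_[3]) * ((ϖ : ℚ_[3]) * (ϖ' : ℚ_[3])) *
        (PowerSeries.coeff 1 Lp * PowerSeries.coeff 1 Bm) := by
    rw [← Wuthrich2014.coeff_iwasawaToPowerSeries 3 fE 2, hιfE, hAV, hAW]
    rw [hL₁, hB₁,
      show iwasawaToPowerSeries 3 h * (PowerSeries.C ((ϖ : ℚ_[3]) * (ϖ' : ℚ_[3])) *
          (PowerSeries.X * L₁ * (PowerSeries.X * B₁))) =
        PowerSeries.X ^ 2 * (iwasawaToPowerSeries 3 h * PowerSeries.C ((ϖ : ℚ_[3]) * (ϖ' : ℚ_[3])) *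
          (L₁ * B₁)) by ring,
      PowerSeries.coeff_X_pow_mul', if_pos le_rfl, Nat.sub_self, PowerSeries.coeff_zero_eq_constantCoeff]
    simp only [map_mul, PowerSeries.constantCoeff_C, constantCoeff_iwasawaToPowerSeries]
  set h0 : ℚ_[3] := ((PowerSeries.constantCoeff h : ℤ_[3]) : ℚ_[3]) with hh0
  set c2 : ℚ_[3] := ((PowerSeries.coeff 2 fE : ℤ_[3]) : ℚ_[3]) with hc2
  set AV : ℚ_[3] := PowerSeries.coeff 1 Lp with hAVdef
  set AW : ℚ_[3] := PowerSeries.coeff 1 Bm with hAWdef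
  set lg : ℚ_[3] := padicLog 3 (cyclotomicGenerator 3) with hlg
  set TK : ℚ_[3] := (Nat.card (AddCommGroup.primaryComponent (V.baseChange K).toAffine.Point 3) : ℚ_[3]) with hTK
  set Np : ℚ_[3] := (Nat.card (AddCommGroup.primaryComponent
    ((integralModelInt V).map (Int.castRingHom (ZMod 3))).toAffine.Point 3) : ℚ_[3]) with hNp
  set ShK : ℚ_[3] := (Nat.card (AddCommGroup.primaryComponent (V.baseChange K).sha 3) : ℚ_[3]) with hShK
  set G : ℚ_[3] := DK.pairing (B 0) (B 0) * DK.pairing (B 1) (B 1) - DK.pairing (B 0) (B 1) ^ 2 with hGdef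
  set R₀ : ℚ_[3] := padicRegulator D₀ with hR₀
  set Rh : ℚ_[3] := padicRegulator Dh with hRh
  set M : ℚ_[3] := ((a * d - b * c : ℤ) : ℚ_[3]) with hMdef
  set vK : ℕ := padicValNat 3 (V.baseChange K).tamagawaProduct with hvK
  have hi : c2 = h0 * ((ϖ : ℚ_[3]) * (ϖ' : ℚ_[3])) * (AV * AW) := hcoeff_ιfE
  have hii : c2 * lg ^ 2 * TK ^ 2 = ((u₁ : ℤ_[3]) : ℚ_[3]) * G * (3 : ℚ_[3]) ^ vK * Np ^ 2 * ShK := hu₁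
  have hiiiV : AV * lg = (q : ℚ_[3]) * (1 - a₀⁻¹) ^ 2 * R₀ := hpr
  have hiiiW : (ϖ' : ℚ_[3]) * AW * lg = ((u : ℤ_[3]) : ℚ_[3]) * (qW : ℚ_[3]) * Rh := by
    exact_mod_cast hpgz
  have hiv : M ^ 2 * G = 4 * R₀ * Rh := hfac
  obtain ⟨u₂, hu₂⟩ := exists_unit_one_sub_unitRoot_inv 3 V hord
  obtain ⟨u₃, hu₃⟩ := exists_unit_natCard_eq_mul_card_primaryComponent
    ((integralModelInt V).map (Int.castRingHom (ZMod 3))).toAffine.Point 3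
  have hNcount : (V.reductionPointCount 3 : ℚ_[3]) = ((u₃ : ℤ_[3]) : ℚ_[3]) * Np := by
    rw [WeierstrassCurve.reductionPointCount, hNp]; exact hu₃
  have hNp0 : Np ≠ 0 := by rw [hNp]; exact_mod_cast Nat.card_pos.ne'
  have h1 : (1 - a₀⁻¹) = ((u₂ : ℤ_[3]) : ℚ_[3]) * ((u₃ : ℤ_[3]) : ℚ_[3]) * Np := by
    rw [ha₀, hu₂, hNcount, mul_assoc]
  obtain ⟨ul, hul⟩ := exists_unit_padicLog_cyclotomicGenerator 3 (by norm_num)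
  have hlg0 : lg ≠ 0 := by
    rw [hlg, hul]; exact mul_ne_zero (by norm_num) (coe_units_ne_zero 3 ul)
  obtain ⟨uT, huT⟩ := exists_unit_torsionOrder_eq (V.baseChange K) 3
  have hTK0 : TK ≠ 0 := by
    intro h0'
    rw [hTK] at h0'
    have h1' : ((V.baseChange K).torsionOrder : ℚ_[3]) = 0 := by rw [huT, h0', mul_zero]
    exact ((V.baseChange K).torsionOrder_pos (V.baseChange K).finite_torsion_holds).ne' (by exact_mod_cast h1')
  have hShK0 : ShK ≠ 0 := by rw [hShK]; exact_mod_cast Nat.card_pos.ne'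
  have hp0 : (3 : ℚ_[3]) ≠ 0 := by exact_mod_cast (by norm_num : (3 : ℕ) ≠ 0)
  have hMQ0 : M ≠ 0 := by rw [hMdef]; exact_mod_cast hm0
  have hϖ'Q : (ϖ' : ℚ_[3]) ≠ 0 := by exact_mod_cast hϖ'0
  have hϖQ : (ϖ : ℚ_[3]) ≠ 0 := by exact_mod_cast hϖ0
  have hqQ : (q : ℚ_[3]) ≠ 0 := by exact_mod_cast hq0
  have hAV0 : AV ≠ 0 := hcertV
  have hAW0 : AW ≠ 0 := hcertW
  have hLHSW0 : (ϖ' : ℚ_[3]) * AW * lg ≠ 0 := mul_ne_zero (mul_ne_zero hϖ'Q hAW0) hlg0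
  have hRh0 : Rh ≠ 0 := fun h0' ↦ hLHSW0 (by rw [hiiiW, h0', mul_zero])
  have hqWQ : (qW : ℚ_[3]) ≠ 0 := fun h0' ↦ hLHSW0 (by rw [hiiiW, h0', mul_zero, zero_mul])
  have hqW0 : qW ≠ 0 := fun h0' ↦ hqWQ (by rw [h0']; push_cast; rfl)
  have hLHSV0 : AV * lg ≠ 0 := mul_ne_zero hAV0 hlg0
  have hR₀0 : R₀ ≠ 0 := fun h0' ↦ hLHSV0 (by rw [hiiiV, h0', mul_zero])
  have hh0val : 0 ≤ h0.valuation := by rw [hh0]; exact PadicInt.valuation_coe_nonneg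
  set UU : ℚ_[3] := ((u : ℤ_[3]) : ℚ_[3]) * (((u₂ : ℤ_[3]) : ℚ_[3]) * ((u₃ : ℤ_[3]) : ℚ_[3])) ^ 2 with hUU
  have hU0 : UU ≠ 0 :=
    mul_ne_zero (coe_units_ne_zero 3 u)
      (pow_ne_zero 2 (mul_ne_zero (coe_units_ne_zero 3 u₂) (coe_units_ne_zero 3 u₃)))
  have key : h0 * UU * ((((ϖ : ℚ_[3]) * (q : ℚ_[3])) * (qW : ℚ_[3])) * TK ^ 2 * M ^ 2) =
      4 * ((u₁ : ℤ_[3]) : ℚ_[3]) * (3 : ℚ_[3]) ^ vK * ShK := by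
    apply mul_right_cancel₀ (mul_ne_zero (mul_ne_zero hR₀0 hRh0) (pow_ne_zero 2 hNp0))
    have e1 : 4 * ((u₁ : ℤ_[3]) : ℚ_[3]) * (3 : ℚ_[3]) ^ vK * ShK * (R₀ * Rh * Np ^ 2) =
        (M ^ 2 * G) * ((u₁ : ℤ_[3]) : ℚ_[3]) * (3 : ℚ_[3]) ^ vK * Np ^ 2 * ShK := by
      rw [hiv]; ring
    have e2 : (M ^ 2 * G) * ((u₁ : ℤ_[3]) : ℚ_[3]) * (3 : ℚ_[3]) ^ vK * Np ^ 2 * ShK =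
        M ^ 2 * (c2 * lg ^ 2 * TK ^ 2) := by
      rw [hii]; ring
    have e3 : M ^ 2 * (c2 * lg ^ 2 * TK ^ 2) =
        M ^ 2 * (h0 * (ϖ : ℚ_[3]) * (AV * lg) * ((ϖ' : ℚ_[3]) * AW * lg) * TK ^ 2) := by
      rw [hi]; ring
    rw [e1, e2, e3, hiiiV, hiiiW, h1, hUU]
    ring
  have hvU : UU.valuation = 0 := by
    rw [hUU, Padic.valuation_mul (coe_units_ne_zero 3 u)
      (pow_ne_zero 2 (mul_ne_zero (coe_units_ne_zero 3 u₂) (coe_units_ne_zero 3 u₃))),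
      Padic.valuation_pow, Padic.valuation_mul (coe_units_ne_zero 3 u₂) (coe_units_ne_zero 3 u₃),
      valuation_coe_units_eq_zero, valuation_coe_units_eq_zero, valuation_coe_units_eq_zero]
    ring
  have hϖq0 : (ϖ : ℚ_[3]) * (q : ℚ_[3]) ≠ 0 := mul_ne_zero hϖQ hqQ
  have htq0 : ((ϖ : ℚ_[3]) * (q : ℚ_[3])) * (qW : ℚ_[3]) ≠ 0 := mul_ne_zero hϖq0 hqWQ
  have hprod0 : (((ϖ : ℚ_[3]) * (q : ℚ_[3])) * (qW : ℚ_[3])) * TK ^ 2 * M ^ 2 ≠ 0 :=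
    mul_ne_zero (mul_ne_zero htq0 (pow_ne_zero 2 hTK0)) (pow_ne_zero 2 hMQ0)
  have h40 : (4 : ℚ_[3]) ≠ 0 := by exact_mod_cast (by norm_num : (4 : ℕ) ≠ 0)
  have hRHS0 : 4 * ((u₁ : ℤ_[3]) : ℚ_[3]) * (3 : ℚ_[3]) ^ vK * ShK ≠ 0 :=
    mul_ne_zero (mul_ne_zero (mul_ne_zero h40 (coe_units_ne_zero 3 u₁)) (pow_ne_zero _ hp0)) hShK0
  have hh0ne : h0 ≠ 0 := fun h0' ↦ hRHS0 (by rw [← key, h0', zero_mul, zero_mul])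
  have hval := congrArg Padic.valuation key
  rw [Padic.valuation_mul (mul_ne_zero hh0ne hU0) hprod0, Padic.valuation_mul hh0ne hU0, hvU,
    Padic.valuation_mul (mul_ne_zero htq0 (pow_ne_zero 2 hTK0)) (pow_ne_zero 2 hMQ0),
    Padic.valuation_mul htq0 (pow_ne_zero 2 hTK0), Padic.valuation_mul hϖq0 hqWQ, Padic.valuation_mul hϖQ hqQ,
    Padic.valuation_pow, Padic.valuation_pow,
    Padic.valuation_mul (mul_ne_zero (mul_ne_zero h40 (coe_units_ne_zero 3 u₁)) (pow_ne_zero _ hp0))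
      hShK0,
    Padic.valuation_mul (mul_ne_zero h40 (coe_units_ne_zero 3 u₁)) (pow_ne_zero _ hp0),
    Padic.valuation_mul h40 (coe_units_ne_zero 3 u₁), valuation_coe_units_eq_zero,
    Padic.valuation_pow] at hval
  have hv3 : (3 : ℚ_[3]).valuation = 1 := by exact_mod_cast Padic.valuation_p (p := 3)
  have hv4 : (4 : ℚ_[3]).valuation = 0 := by
    have h : ((4 : ℚ) : ℚ_[3]).valuation = padicValRat 3 (4 : ℚ) := Padic.valuation_ratCast 4
    rw [show padicValRat 3 (4 : ℚ) = 0 by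
      rw [show (4 : ℚ) = ((4 : ℕ) : ℚ) by norm_num, padicValRat.of_nat]; norm_num [padicValNat.eq_zero_of_not_dvd]] at h
    exact_mod_cast h
  rw [hv3, hv4] at hval
  have hvTK : TK.valuation = (padicValNat 3 (V.baseChange K).torsionOrder : ℤ) := by
    have h := congrArg Padic.valuation huT
    rw [Padic.valuation_natCast, Padic.valuation_mul (coe_units_ne_zero 3 uT) hTK0,
      valuation_coe_units_eq_zero, zero_add] at h
    exact h.symm
  have hvShK : ShK.valuation = (padicValNat 3 (V.baseChange K).shaOrder : ℤ) := by
    rw [hShK, Padic.valuation_natCast, padicValNat_card_addPrimaryComponent 3]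
    rfl
  have hvMv : M.valuation = padicValRat 3 ((a * d - b * c : ℤ) : ℚ) := by
    rw [hMdef, show ((a * d - b * c : ℤ) : ℚ_[3]) = (((a * d - b * c : ℤ) : ℚ) : ℚ_[3]) by push_cast; rfl,
      Padic.valuation_ratCast]
  have hvϖ : (ϖ : ℚ_[3]).valuation = padicValRat 3 ϖ := Padic.valuation_ratCast ϖ
  have hvq : (q : ℚ_[3]).valuation = padicValRat 3 q := Padic.valuation_ratCast q
  have hvqW : (qW : ℚ_[3]).valuation = padicValRat 3 qW := Padic.valuation_ratCast qW
  rw [hvTK, hvShK, hvMv, hvϖ, hvq, hvqW] at hval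
  have hI : padicValRat 3 ϖ + padicValRat 3 q + padicValRat 3 qW + 2 * padicValNat 3 (V.baseChange K).torsionOrder +
      2 * padicValRat 3 ((a * d - b * c : ℤ) : ℚ) ≤ (vK : ℤ) + padicValNat 3 (V.baseChange K).shaOrder := by
    simp only [Nat.cast_ofNat] at hval
    linarith
  have hcV0 : (V.tamagawaProduct : ℚ) ≠ 0 := by exact_mod_cast V.tamagawaProduct_pos_holds.ne'
  have hcW0 : (W.tamagawaProduct : ℚ) ≠ 0 := by exact_mod_cast W.tamagawaProduct_pos_holds.ne'
  have hNV0 : (V.torsionOrder : ℚ) ≠ 0 := by exact_mod_cast (V.torsionOrder_pos V.finite_torsion_holds).ne'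
  have hNW0 : (W.torsionOrder : ℚ) ≠ 0 := by exact_mod_cast (W.torsionOrder_pos W.finite_torsion_holds).ne'
  refine ⟨q * ϖ * (V.torsionOrder : ℚ) ^ 2 / (V.tamagawaProduct : ℚ),
    qW * (W.torsionOrder : ℚ) ^ 2 / (W.tamagawaProduct : ℚ), hshaV, hshaW, ?_⟩
  rw [padicValRat.div (mul_ne_zero (mul_ne_zero hq0 hϖ0) (pow_ne_zero 2 hNV0)) hcV0,
    padicValRat.mul (mul_ne_zero hq0 hϖ0) (pow_ne_zero 2 hNV0), padicValRat.mul hq0 hϖ0, padicValRat.pow,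
    padicValRat.of_nat, padicValRat.of_nat,
    padicValRat.div (mul_ne_zero hqW0 (pow_ne_zero 2 hNW0)) hcW0,
    padicValRat.mul hqW0 (pow_ne_zero 2 hNW0), padicValRat.pow, padicValRat.of_nat, padicValRat.of_nat]
  rw [hvu] at hvcard
  push_cast at hI hvcard ⊢
  linarith

end Core

end Summit.BirchSwinnertonDyer.Rank1Residual.Additive

end
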